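import Summits.HubbardSuperconductivity.HubbardSuperconductivity.Theorems.AnisotropyChordStiffnessDoobTeleportWalk
import Summits.HubbardSuperconductivity.HubbardSuperconductivity.Theorems.AnisotropyChordStiffnessDoobDictionary

/-!
# Route `AnisotropyChord` / H0 rotor rung: THE CONVERSE RUNG N⁻ END TO END — teleport-loop families with bounded
# site-congestion ⇒ Doob winding stiffness ⇒ (S_tw) (port of theory seat `hubbard-h0-rotor-theory-1`, cycle 10,
# `Sketch10.lean` Part K, memo ROTOR-THEORY-10 §141/§143(o); work-order v9 = verbatim port)

* `TeleportFamily` (data of finitely many teleport loops: background, free closed site-walk), `start`, `conf`, `mult`;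
* **`card_filter_mult_ne_zero_le`** — site-congestion `n₁` ⇒ at most `2n₁` loops per hop-edge (the stub `hmult`
  discharged); **`windingEnergy_ge_of_teleportFamily`** — `L² Σ_i a(σ_i)² ≤ 8 n₁ ℓ B² · W_j(a; g)` for every `g`;
* the typed hypothesis **`GoodTeleportFamilies Δ M κ C`** («one-particle defects are deconfined ALONG winding cycles of
  cheap sites»; `N` twin `GoodTeleportFamiliesN`) and **`doobWindingStiffness_of_goodTeleportFamilies`** (`Υ₀ = 2κ/C`),
  **`variationalTwistStiffness_of_goodTeleportFamilies`** (hypothesis (S_tw) of H0 via the dictionary); `N` twins.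
Rung currency: N⁻ = «defects deconfined along winding cycles of cheap sites (κ, C) ⇒ (S_tw)» PROVED; nothing here
claims `GoodTeleportFamilies` for `H(Δ)` (measured on the cycle-9 BEC state: θ > 0.9, B² L-flat for β ≤ 0.5, theory
seat REPORT 2).  Typing/proof authority: theory seat `hubbard-h0-rotor-theory-1`, cycle 10.
-/

set_option linter.dupNamespace false

noncomputable section

open Matrix Complex Finset Filter Topology
open scoped ComplexConjugate
open Literature.MathematicalPhysics.QuantumLattice hiding torusPhase torusNorm
open Literature.Probability.LatticeModels
open Summit.HubbardSuperconductivity.HubbardSuperconductivity.Theorems.AnisotropyChord.InsertionEntropy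
  (torusPhase norm_torusPhase IsPerronSectorGroundAmplitude)
open Summit.HubbardSuperconductivity.HubbardSuperconductivity.Theorems.AnisotropyChord.Stiffness

/-! ## K. N⁻ ASSEMBLED: teleport-loop families with bounded site-congestion (discharges `hmult`)

A `TeleportFamily` is the data of finitely many teleport loops (background `σ⁻_i`, empty closed site-walk).
The only genuinely combinatorial input left is the SITE-CONGESTION count `hcount`: for every background `η'`
and site `z`, at most `n₁` loops of the family have background `η'` and visit `z` (for the canonical family of
§141 — disjoint winding cycles, starters adjacent to them — `n₁ ≤ 3ℓ + 5`).  From it, every hop-edge carries at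
most `2 n₁` loops (`card_filter_mult_ne_zero_le`), and `windingEnergy_ge_of_simpleLoops` yields the N⁻ bound
`L² Σ_i a(σ_i)² ≤ 8 n₁ ℓ B² · W_j(a; g)` (`windingEnergy_ge_of_teleportFamily`).  Packaging the hypotheses
along `L → ∞` (`GoodTeleportFamilies`) gives **`doobWindingStiffness_of_goodTeleportFamilies`** — the converse
rung N⁻ with NO stub left on the network side. -/

namespace Summit.HubbardSuperconductivity.HubbardSuperconductivity.Theorems.AnisotropyChord.Stiffness.Doob

variable {L : ℕ} [NeZero L]

/-- Data of a family of teleport loops. [new: theory seat hubbard-h0-rotor-theory-1, cycle 10, 2026-08-28] -/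
structure TeleportFamily (L : ℕ) [NeZero L] (ι : Type*) where
  len : ι → ℕ
  bg : ι → TensorIndex (TorusSite 2 L) 2
  walk : (i : ι) → ClosedSiteWalk L (len i)
  empty : ∀ i k, bg i ((walk i).site k) = 0

namespace TeleportFamily

variable {ι : Type*} (F : TeleportFamily L ι)

/-- the starter configuration `σ_i = σ⁻_i ∪ {c_i(0)}` -/
def start (i : ι) : TensorIndex (TorusSite 2 L) 2 := Function.update (F.bg i) ((F.walk i).site 0) 1

/-- the `k`-th one-defect configuration of loop `i` -/
def conf (i : ι) (k : Fin (F.len i + 1)) : TensorIndex (TorusSite 2 L) 2 :=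
  Function.update (F.bg i) ((F.walk i).site k) 1

/-- the multiplicity function (circulation) of loop `i` -/
def mult (i : ι) : HopEdge L → ℝ := (teleportWalk (F.bg i) (F.walk i) (F.empty i)).mult

/-- **Site-congestion ⇒ edge-congestion**: at most `2 n₁` loops per hop-edge. [new: theory seat
hubbard-h0-rotor-theory-1, cycle 10, 2026-08-28] -/
theorem card_filter_mult_ne_zero_le [DecidableEq ι] (S : Finset ι) (n₁ : ℕ)
    (hcount : ∀ (η : TensorIndex (TorusSite 2 L) 2) (z : TorusSite 2 L),
      (S.filter (fun i => F.bg i = Function.update η z 0 ∧ ∃ k, (F.walk i).site k = z)).card ≤ n₁)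
    (e : HopEdge L) : (S.filter (fun i => F.mult i e ≠ 0)).card ≤ 2 * n₁ := by
  classical
  set η := e.2
  set x : TorusSite 2 L := e.1.1
  set y : TorusSite 2 L := e.1.1 + Pi.single e.1.2 1
  let A : TorusSite 2 L → Finset ι :=
    fun z => S.filter (fun i => F.bg i = Function.update η z 0 ∧ ∃ k, (F.walk i).site k = z)
  have hsub : S.filter (fun i => F.mult i e ≠ 0) ⊆ A x ∪ A y := by
    intro i hi
    rw [mem_filter] at hi
    obtain ⟨hiS, hne⟩ := hi
    have hpos : 0 < F.mult i e :=
      lt_of_le_of_ne ((teleportWalk (F.bg i) (F.walk i) (F.empty i)).mult_nonneg e) (Ne.symm hne)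
    obtain ⟨k, hk⟩ := (teleportWalk (F.bg i) (F.walk i) (F.empty i)).exists_of_mult_pos hpos
    -- read off background and defect position from the edge
    have hk1 : ((F.walk i).lo k, (F.walk i).ax k) = e.1 := congrArg Prod.fst hk
    have hk2 : Function.update (F.bg i) ((F.walk i).site k.castSucc) 1 = η := congrArg Prod.snd hk
    have hbg : F.bg i = Function.update η ((F.walk i).site k.castSucc) 0 := by
      rw [← hk2, Function.update_idem, eq_comm, Function.update_eq_self_iff]
      exact (F.empty i _).symm
    have hlo : (F.walk i).lo k = x := congrArg Prod.fst hk1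
    have hax : (F.walk i).ax k = e.1.2 := congrArg Prod.snd hk1
    rw [mem_union]
    rcases (F.walk i).step k with ⟨h1, _⟩ | ⟨h1, _⟩
    · left
      have hsx : (F.walk i).site k.castSucc = x := h1.trans hlo
      exact mem_filter.2 ⟨hiS, by rw [hbg, hsx], ⟨k.castSucc, hsx⟩⟩
    · right
      have hsy : (F.walk i).site k.castSucc = y := by rw [h1, hlo, hax]
      exact mem_filter.2 ⟨hiS, by rw [hbg, hsy], ⟨k.castSucc, hsy⟩⟩
  calc (S.filter (fun i => F.mult i e ≠ 0)).card ≤ (A x ∪ A y).card := card_le_card hsub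
    _ ≤ (A x).card + (A y).card := card_union_le _ _
    _ ≤ n₁ + n₁ := Nat.add_le_add (hcount η x) (hcount η y)
    _ = 2 * n₁ := by ring

/-- **N⁻, network side, fully proved**: a teleport-loop family with distinct directed steps, one winding of
axis `j`, positive and on-average-flat one-defect amplitude profiles (`B²`), walk lengths `≤ ℓ`, and
site-congestion `≤ n₁` forces `L² · Σ_i a(σ_i)² ≤ 8 n₁ ℓ B² · W_j(a; g)` for every potential `g`.
[new: theory seat hubbard-h0-rotor-theory-1, cycle 10, 2026-08-28] -/
theorem windingEnergy_ge_of_teleportFamily [DecidableEq ι] (S : Finset ι) (hlen : ∀ i ∈ S, 0 < F.len i)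
    (j : Fin 2)
    (hsteps : ∀ i ∈ S, ∀ k k' : Fin (F.len i), (F.walk i).site k.castSucc = (F.walk i).site k'.castSucc →
      (F.walk i).site k.succ = (F.walk i).site k'.succ → k = k')
    (hwind : ∀ i ∈ S, (L : ℝ) ^ 2 ≤ (F.walk i).disp j ^ 2)
    (a : TensorIndex (TorusSite 2 L) 2 → ℝ) (ha : ∀ σ, 0 ≤ a σ) (hpos : ∀ i ∈ S, ∀ k, 0 < a (F.conf i k))
    (B2 : ℝ) (hB2 : 0 ≤ B2) (ℓ : ℕ) (hℓ : ∀ i ∈ S, F.len i ≤ ℓ)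
    (hflat : ∀ i ∈ S, ∑ k : Fin (F.len i), (a (F.start i) / a (F.conf i k.castSucc)) ^ 2 ≤ F.len i * B2)
    (n₁ : ℕ)
    (hcount : ∀ (η : TensorIndex (TorusSite 2 L) 2) (z : TorusSite 2 L),
      (S.filter (fun i => F.bg i = Function.update η z 0 ∧ ∃ k, (F.walk i).site k = z)).card ≤ n₁)
    (g : TensorIndex (TorusSite 2 L) 2 → ℝ) :
    (L : ℝ) ^ 2 * ∑ i ∈ S, a (F.start i) ^ 2 ≤ (((2 * n₁ : ℕ) : ℝ) * (4 * ℓ * B2)) * windingEnergy a j g := by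
  have spec : ∀ i ∈ S, _ := fun i hi =>
    teleportLoop_spec (F.bg i) (F.walk i) (F.empty i) (hlen i hi) j (hsteps i hi) (hwind i hi) a
      (hpos i hi) B2 (hflat i hi)
  refine windingEnergy_ge_of_simpleLoops S a ha j F.mult (fun i hi => (spec i hi).1)
    (fun i => a (F.start i) ^ 2) (fun i _ => sq_nonneg _) (4 * ℓ * B2) (by positivity) ?_ (2 * n₁)
    (F.card_filter_mult_ne_zero_le S n₁ hcount) g
  intro i hi
  calc a (F.start i) ^ 2 * Loop.resistance (hopCond a) (F.mult i)
      ≤ 4 * (F.len i : ℝ) * B2 := (spec i hi).2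
    _ ≤ 4 * ℓ * B2 := by
        have : (F.len i : ℝ) ≤ ℓ := by exact_mod_cast hℓ i hi
        nlinarith

end TeleportFamily

/-- `W_j(a; g) ≥ 0` for a non-negative amplitude. [folklore] -/
theorem windingEnergy_nonneg' (a : TensorIndex (TorusSite 2 L) 2 → ℝ) (ha : ∀ σ, 0 ≤ a σ) (j : Fin 2)
    (g : TensorIndex (TorusSite 2 L) 2 → ℝ) : 0 ≤ windingEnergy a j g := by
  rw [windingEnergy_eq_energy]
  unfold Loop.energy
  exact sum_nonneg fun e _ => mul_nonneg (hopCond_nonneg ha e) (sq_nonneg _)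

/-- **HYPOTHESIS N⁻ (typed): GOOD TELEPORT FAMILIES.**  Eventually in `L`, every Perron sector ground amplitude
of sector `M_L − 1` admits, for each axis `j`, a teleport-loop family with the N⁻ properties whose starter
π-mass is `≥ κ L²` (≈ θ N good (σ, P) pairs) and whose constant `8 n₁ ℓ B²` is `≤ C L²` (walk length and
site-congestion both `O(L)`, flatness `O(1)`).  Informal content: «one-particle defects are deconfined ALONG
winding cycles of cheap sites» (memo ROTOR-THEORY-10 §141, §143(n)). [conjecture: theory seat
hubbard-h0-rotor-theory-1, cycle 10, 2026-08-28] -/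
def GoodTeleportFamilies (Δ : ℝ) (M : ℕ → ℝ) (κ C : ℝ) : Prop :=
  ∀ᶠ L : ℕ in atTop, ∀ [NeZero L],
    ∀ a : TensorIndex (TorusSite 2 L) 2 → ℝ, IsPerronSectorGroundAmplitude L Δ (M L - 1) a → ∀ j : Fin 2,
      ∃ (ι : Type) (_ : DecidableEq ι) (F : TeleportFamily L ι) (S : Finset ι) (ℓ n₁ : ℕ) (B2 : ℝ),
        (∀ i ∈ S, 0 < F.len i) ∧
        (∀ i ∈ S, ∀ k k' : Fin (F.len i), (F.walk i).site k.castSucc = (F.walk i).site k'.castSucc →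
          (F.walk i).site k.succ = (F.walk i).site k'.succ → k = k') ∧
        (∀ i ∈ S, (L : ℝ) ^ 2 ≤ (F.walk i).disp j ^ 2) ∧
        (∀ i ∈ S, ∀ k, 0 < a (F.conf i k)) ∧
        0 ≤ B2 ∧ (∀ i ∈ S, F.len i ≤ ℓ) ∧
        (∀ i ∈ S, ∑ k : Fin (F.len i), (a (F.start i) / a (F.conf i k.castSucc)) ^ 2 ≤ F.len i * B2) ∧
        (∀ (η : TensorIndex (TorusSite 2 L) 2) (z : TorusSite 2 L),
          (S.filter (fun i => F.bg i = Function.update η z 0 ∧ ∃ k, (F.walk i).site k = z)).card ≤ n₁) ∧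
        κ * (L : ℝ) ^ 2 ≤ ∑ i ∈ S, a (F.start i) ^ 2 ∧
        (((2 * n₁ : ℕ) : ℝ) * (4 * ℓ * B2)) ≤ C * (L : ℝ) ^ 2

/-- **RUNG N⁻ (converse of H0's defect picture), end-to-end on the network side: good teleport families ⇒
uniform Doob winding stiffness** (hence, by the dictionary, `VariationalTwistStiffness`), with
`Υ₀ = 2κ/C`. [new: theory seat hubbard-h0-rotor-theory-1, cycle 10, 2026-08-28] -/
theorem doobWindingStiffness_of_goodTeleportFamilies (Δ : ℝ) (M : ℕ → ℝ) {κ C : ℝ} (hκ : 0 < κ)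
    (hC : 0 < C) (h : GoodTeleportFamilies Δ M κ C) : DoobWindingStiffness Δ M := by
  refine ⟨2 * κ / C, by positivity, ?_⟩
  filter_upwards [h, eventually_gt_atTop 0] with L hL hL0
  intro _ a ha j g
  obtain ⟨ι, _, F, S, ℓ, n₁, B2, hlen, hsteps, hwind, hpos, hB2, hℓ, hflat, hcount, hmass, hconst⟩ := hL a ha j
  have key := F.windingEnergy_ge_of_teleportFamily S hlen j hsteps hwind a ha.nonneg hpos B2 hB2 ℓ hℓ hflat n₁
    hcount g
  have hW := windingEnergy_nonneg' a ha.nonneg j g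
  have hL2 : (0 : ℝ) < (L : ℝ) ^ 2 := by positivity
  -- κ L² · L² ≤ L² Σπ ≤ n₀M · W ≤ C L² · W
  have h1 : (L : ℝ) ^ 2 * (κ * (L : ℝ) ^ 2) ≤ C * (L : ℝ) ^ 2 * windingEnergy a j g :=
    calc (L : ℝ) ^ 2 * (κ * (L : ℝ) ^ 2) ≤ (L : ℝ) ^ 2 * ∑ i ∈ S, a (F.start i) ^ 2 :=
          mul_le_mul_of_nonneg_left hmass hL2.le
      _ ≤ (((2 * n₁ : ℕ) : ℝ) * (4 * ℓ * B2)) * windingEnergy a j g := key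
      _ ≤ C * (L : ℝ) ^ 2 * windingEnergy a j g := mul_le_mul_of_nonneg_right hconst hW
  have h2 : κ * (L : ℝ) ^ 2 ≤ C * windingEnergy a j g := by
    have := h1; nlinarith
  rw [div_mul_eq_mul_div, div_div, div_le_iff₀ (by positivity)]
  nlinarith

/-- N⁻ in the audited currency: good teleport families ⇒ `VariationalTwistStiffness` (by the dictionary of
Part F). [new: theory seat hubbard-h0-rotor-theory-1, cycle 10, 2026-08-28] -/
theorem variationalTwistStiffness_of_goodTeleportFamilies (Δ : ℝ) (M : ℕ → ℝ) {κ C : ℝ} (hκ : 0 < κ)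
    (hC : 0 < C) (h : GoodTeleportFamilies Δ M κ C) : VariationalTwistStiffness Δ M :=
  (doobWindingStiffness_iff_variational Δ M).1 (doobWindingStiffness_of_goodTeleportFamilies Δ M hκ hC h)

/-- N-sector twin of the typed hypothesis (sector `M_L`; one-state chain). [conjecture: theory seat
hubbard-h0-rotor-theory-1, cycle 10, 2026-08-28] -/
def GoodTeleportFamiliesN (Δ : ℝ) (M : ℕ → ℝ) (κ C : ℝ) : Prop :=
  ∀ᶠ L : ℕ in atTop, ∀ [NeZero L],
    ∀ a : TensorIndex (TorusSite 2 L) 2 → ℝ, IsPerronSectorGroundAmplitude L Δ (M L) a → ∀ j : Fin 2,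
      ∃ (ι : Type) (_ : DecidableEq ι) (F : TeleportFamily L ι) (S : Finset ι) (ℓ n₁ : ℕ) (B2 : ℝ),
        (∀ i ∈ S, 0 < F.len i) ∧
        (∀ i ∈ S, ∀ k k' : Fin (F.len i), (F.walk i).site k.castSucc = (F.walk i).site k'.castSucc →
          (F.walk i).site k.succ = (F.walk i).site k'.succ → k = k') ∧
        (∀ i ∈ S, (L : ℝ) ^ 2 ≤ (F.walk i).disp j ^ 2) ∧
        (∀ i ∈ S, ∀ k, 0 < a (F.conf i k)) ∧
        0 ≤ B2 ∧ (∀ i ∈ S, F.len i ≤ ℓ) ∧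
        (∀ i ∈ S, ∑ k : Fin (F.len i), (a (F.start i) / a (F.conf i k.castSucc)) ^ 2 ≤ F.len i * B2) ∧
        (∀ (η : TensorIndex (TorusSite 2 L) 2) (z : TorusSite 2 L),
          (S.filter (fun i => F.bg i = Function.update η z 0 ∧ ∃ k, (F.walk i).site k = z)).card ≤ n₁) ∧
        κ * (L : ℝ) ^ 2 ≤ ∑ i ∈ S, a (F.start i) ^ 2 ∧
        (((2 * n₁ : ℕ) : ℝ) * (4 * ℓ * B2)) ≤ C * (L : ℝ) ^ 2

/-- N-sector rung N⁻. [new: theory seat hubbard-h0-rotor-theory-1, cycle 10, 2026-08-28] -/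
theorem doobWindingStiffnessN_of_goodTeleportFamiliesN (Δ : ℝ) (M : ℕ → ℝ) {κ C : ℝ} (hκ : 0 < κ)
    (hC : 0 < C) (h : GoodTeleportFamiliesN Δ M κ C) : DoobWindingStiffnessN Δ M := by
  refine ⟨2 * κ / C, by positivity, ?_⟩
  filter_upwards [h, eventually_gt_atTop 0] with L hL hL0
  intro _ a ha j g
  obtain ⟨ι, _, F, S, ℓ, n₁, B2, hlen, hsteps, hwind, hpos, hB2, hℓ, hflat, hcount, hmass, hconst⟩ := hL a ha j
  have key := F.windingEnergy_ge_of_teleportFamily S hlen j hsteps hwind a ha.nonneg hpos B2 hB2 ℓ hℓ hflat n₁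
    hcount g
  have hW := windingEnergy_nonneg' a ha.nonneg j g
  have hL2 : (0 : ℝ) < (L : ℝ) ^ 2 := by positivity
  have h1 : (L : ℝ) ^ 2 * (κ * (L : ℝ) ^ 2) ≤ C * (L : ℝ) ^ 2 * windingEnergy a j g :=
    calc (L : ℝ) ^ 2 * (κ * (L : ℝ) ^ 2) ≤ (L : ℝ) ^ 2 * ∑ i ∈ S, a (F.start i) ^ 2 :=
          mul_le_mul_of_nonneg_left hmass hL2.le
      _ ≤ (((2 * n₁ : ℕ) : ℝ) * (4 * ℓ * B2)) * windingEnergy a j g := key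
      _ ≤ C * (L : ℝ) ^ 2 * windingEnergy a j g := mul_le_mul_of_nonneg_right hconst hW
  have h2 : κ * (L : ℝ) ^ 2 ≤ C * windingEnergy a j g := by
    have := h1; nlinarith
  rw [div_mul_eq_mul_div, div_div, div_le_iff₀ (by positivity)]
  nlinarith

/-- N-sector rung N⁻ in the audited currency. [new: theory seat hubbard-h0-rotor-theory-1, cycle 10, 2026-08-28] -/
theorem variationalTwistStiffnessN_of_goodTeleportFamiliesN (Δ : ℝ) (M : ℕ → ℝ) {κ C : ℝ} (hκ : 0 < κ)
    (hC : 0 < C) (h : GoodTeleportFamiliesN Δ M κ C) : VariationalTwistStiffnessN Δ M :=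
  (doobWindingStiffnessN_iff_variationalN Δ M).1 (doobWindingStiffnessN_of_goodTeleportFamiliesN Δ M hκ hC h)

end Summit.HubbardSuperconductivity.HubbardSuperconductivity.Theorems.AnisotropyChord.Stiffness.Doob
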